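import Mathlib

/-!
# Tier4/Line1/RTFSetting — LINE L1: the generic relative-trace-formula layer (DEFINITIONS + proved glue; NO `sorry`)

Blind re-derivation cell `pub-hodge-repro`, Tier 4 «prove the step» (README §9–§10), seat t4-plan-1.  This module is
PART I of the line's skeleton proofs/t4-plan-1/Tier4/Line1/Skeleton.lean (v0.8 12c8528bc811170c · 949 l.; the FILED
hash is v0.7 9a75e88952e09d0a, S12132 — the two differ only by `Setting.IsIrreducible` and the field
`IsAdaptedONB.irred`, see below), split out at the lead's instruction (S12132: «split Part I into
Tier4/Line1/RTFSetting.lean and PROPOSE it now, Mathlib-only, so provers import the definitions by name»).  It imports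
ONLY Mathlib and contains ONLY definitions and proved glue: the structure `RTF.Setting G` (rational points, two tori,
the centre, Haar measures, fundamental domains — every hypothesis a DEFINED Mathlib predicate), the test functions, the
kernel `K_f`, the right-regular action `R(f)`, convolution, the toric functionals, the distribution `J(f)`, the rational
double cosets and their orbital terms, the geometric support, regularity, the `L²(DG)` inner product, characters, the
central match, invariant subspaces, IRREDUCIBILITY, adapted orthonormal families, `Hit`, `PeriodNonzeroT/T'`, and the
glue lemmas `IsTest.refl`, `IsTest.cj`, `exists_term_ne_zero`, `orbital_eq_zero_of_not_mem`, `atoms`.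

The five prover-facing generic lemmas of the line are NOT here (they are `sorry` in the skeleton and land as
Tier4/Line1/<Name>.lean, each importing this module and restating its theorem BYTE-IDENTICALLY inside
`namespace Summit.Ventures.HodgeRepro.Tier4.Line1.RTF.Setting` with `variable (S : Setting G)`):
L1.0 `kernel_support_finite`, L1.0′ `geoSupport_finite`, L1.1 `rtf_geometric`, L1.2a `kernel_spectral`,
L1.2b `rtf_spectral`.  The two glue lemmas that CONSUME them (`J_eq_orbital_of_isolated`, `exists_periods_of_isolation`)
stay in the skeleton and move to the line's assembly module once the five land.

`IsAdaptedONB.irred` (v0.8): without it `τ 0 :=` every continuous invariant function (with a continuous ONB of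
`L²(DG)`) is an adapted family, so the line's defined conclusion «both toric functionals non-zero on `τ m`» would carry
no content; with it `τ m` is (topologically) irreducible — every invariant subspace of `τ m` is zero or `L²(DG)`-dense
in it — which is the DEFINED trace of «an irreducible automorphic representation».  The five generic lemmas never use
the field.

Nothing here says anything about the status of the Hodge conjecture for CM abelian varieties, which is NOT proved
(HC_CM is NOT proved by anyone in this repository).
-/

set_option autoImplicit false

noncomputable section

namespace Summit.Ventures.HodgeRepro.Tier4.Line1

open MeasureTheory Topology

namespace RTF

variable (G : Type) [Group G] [TopologicalSpace G] [IsTopologicalGroup G] [MeasurableSpace G]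
  [BorelSpace G]

/-- The data of a relative trace formula on `G`: rational points, two tori, the centre, Haar measures (`μ` bi-invariant:
the instance is unimodular) and fundamental domains (parameters with Mathlib's DEFINED predicates). -/
structure Setting where
  Gk : Subgroup G
  T : Subgroup G
  T' : Subgroup G
  Z : Subgroup G
  μ : Measure G
  μT : Measure T
  μT' : Measure T'
  DG : Set G
  DT : Set T
  DT' : Set T'
  haar : μ.IsHaarMeasure
  rightInv : μ.IsMulRightInvariant
  haarT : μT.IsHaarMeasure
  haarT' : μT'.IsHaarMeasure
  fdG : IsFundamentalDomain Gk DG μ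
  fdT : IsFundamentalDomain (Gk.subgroupOf T) DT μT
  fdT' : IsFundamentalDomain (Gk.subgroupOf T') DT' μT'
  compG : IsCompact (closure DG)
  compT : IsCompact (closure DT)
  compT' : IsCompact (closure DT')
  discrete : DiscreteTopology Gk
  closed : IsClosed (Gk : Set G)
  ZleT : Z ≤ T
  ZleT' : Z ≤ T'
  central : ∀ z ∈ Z, ∀ g : G, z * g = g * z

variable {G}

/-- a test function: continuous with compact support -/
structure IsTest (f : G → ℂ) : Prop where
  cont : Continuous f
  compact : HasCompactSupport f

/-- the reflected test function `fˇ(g) = f(g⁻¹)` -/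
def refl (f : G → ℂ) (g : G) : ℂ := f g⁻¹

/-- the conjugate test function `f̄(g) = conj f(g)` -/
def cj (f : G → ℂ) (g : G) : ℂ := starRingEnd ℂ (f g)

omit [MeasurableSpace G] [BorelSpace G] in
/-- glue (S, proved): the reflected and conjugated test functions are test functions. -/
theorem IsTest.refl {f : G → ℂ} (hf : IsTest f) : IsTest (refl f) :=
  ⟨hf.cont.comp continuous_inv, hf.compact.comp_homeomorph (Homeomorph.inv G)⟩

omit [Group G] [IsTopologicalGroup G] [MeasurableSpace G] [BorelSpace G] in
/-- glue (S, proved): the conjugate of a test function is a test function. -/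
theorem IsTest.cj {f : G → ℂ} (hf : IsTest f) : IsTest (cj f) :=
  ⟨(continuous_star : Continuous (starRingEnd ℂ)).comp hf.cont,
    hf.compact.comp_left (map_zero (starRingEnd ℂ))⟩

/-- glue (S, proved): a convergent series with a non-zero sum has a non-zero term. -/
theorem exists_term_ne_zero {a : ℕ → ℂ} {s : ℂ} (h : HasSum a s) (hs : s ≠ 0) : ∃ j, a j ≠ 0 := by
  by_contra hcon
  apply hs
  have h0 : ∀ j, a j = 0 := fun j => by
    by_contra hj
    exact hcon ⟨j, hj⟩
  have : HasSum a 0 := by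
    have : a = fun _ => 0 := funext h0
    rw [this]
    exact hasSum_zero
  exact h.unique this

namespace Setting

variable (S : Setting G)

/-- the automorphic kernel `K_f(x, y) = ∑_{γ ∈ G(k)} f(x⁻¹ γ y)` -/
def kernel (f : G → ℂ) (x y : G) : ℂ := ∑' γ : S.Gk, f (x⁻¹ * γ * y)

/-- the right-regular action `R(f) φ (x) = ∫ f(g) φ(x g) dμ(g)` -/
def R (f φ : G → ℂ) (x : G) : ℂ := ∫ g, f g * φ (x * g) ∂S.μ

/-- convolution `(f₁ ⋆ f₂)(g) = ∫ f₁(h) f₂(h⁻¹ g) dμ(h)` -/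
def conv (f₁ f₂ : G → ℂ) (g : G) : ℂ := ∫ h, f₁ h * f₂ (h⁻¹ * g) ∂S.μ

/-- the `χ`-equivariant toric functional along `T`: `ℓ_χ(a) = ∫_{[T]} a(t) conj χ(t)`, over the fundamental
domain `DT` -/
def periodT (χ a : S.T → ℂ) : ℂ := ∫ t in S.DT, a t * starRingEnd ℂ (χ t) ∂S.μT

/-- the `χ'`-equivariant toric functional along `T'` -/
def periodT' (χ' a : S.T' → ℂ) : ℂ := ∫ t in S.DT', a t * starRingEnd ℂ (χ' t) ∂S.μT'

/-- the relative trace formula distribution `J(f) = ∫_{[T]} ∫_{[T']} K_f(t, t') χ(t) conj χ'(t')` -/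
def J (χ : S.T → ℂ) (χ' : S.T' → ℂ) (f : G → ℂ) : ℂ :=
  ∫ t in S.DT, ∫ t' in S.DT', S.kernel f t t' * χ t * starRingEnd ℂ (χ' t') ∂S.μT' ∂S.μT

/-- `T(k)` as a subgroup of `G(k)` -/
abbrev Tk : Subgroup S.Gk := S.T.subgroupOf S.Gk
/-- `T'(k)` as a subgroup of `G(k)` -/
abbrev T'k : Subgroup S.Gk := S.T'.subgroupOf S.Gk
/-- `Z(k)` as a subgroup of `G(k)` -/
abbrev Zk : Subgroup S.Gk := S.Z.subgroupOf S.Gk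

/-- the rational double cosets `T(k) \ G(k) / T'(k)` -/
abbrev Orbit : Type := DoubleCoset.Quotient (S.Tk : Set S.Gk) (S.T'k : Set S.Gk)

/-- the double coset of a rational element -/
def orbitOf (γ : S.Gk) : S.Orbit := DoubleCoset.mk S.Tk S.T'k γ

/-- the partial kernel of one rational double coset -/
def partialKernel (o : S.Orbit) (f : G → ℂ) (x y : G) : ℂ :=
  ∑' γ : {γ : S.Gk // S.orbitOf γ = o}, f (x⁻¹ * γ.1 * y)

/-- the orbital term of one rational double coset -/
def orbital (χ : S.T → ℂ) (χ' : S.T' → ℂ) (o : S.Orbit) (f : G → ℂ) : ℂ :=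
  ∫ t in S.DT, ∫ t' in S.DT', S.partialKernel o f t t' * χ t * starRingEnd ℂ (χ' t') ∂S.μT' ∂S.μT

/-- the rational double cosets meeting the support of `f` on `DT × DT'` -/
def geoSupport (f : G → ℂ) : Set S.Orbit :=
  {o | ∃ t ∈ S.DT, ∃ t' ∈ S.DT', ∃ γ : S.Gk, S.orbitOf γ = o ∧ f ((t : G)⁻¹ * γ * t') ≠ 0}

/-- `γ` is regular: its stabiliser in `T(k) × T'(k)` is the diagonal centre -/
def Regular (γ : S.Gk) : Prop :=
  ∀ t ∈ S.Tk, ∀ t' ∈ S.T'k, t * γ * t'⁻¹ = γ → t ∈ S.Zk ∧ t' = t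

/-- the `L²(G(k)\G)` inner product over the fundamental domain -/
def inner (φ ψ : G → ℂ) : ℂ := ∫ x in S.DG, φ x * starRingEnd ℂ (ψ x) ∂S.μ

/-- a continuous unitary character of `[T]` -/
structure IsCharacter (χ : S.T → ℂ) : Prop where
  cont : Continuous χ
  map_mul : ∀ a b, χ (a * b) = χ a * χ b
  unit : ∀ a, ‖χ a‖ = 1
  rational : ∀ a ∈ S.Gk.subgroupOf S.T, χ a = 1

/-- a continuous unitary character of `[T']` -/
structure IsCharacter' (χ' : S.T' → ℂ) : Prop where
  cont : Continuous χ'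
  map_mul : ∀ a b, χ' (a * b) = χ' a * χ' b
  unit : ∀ a, ‖χ' a‖ = 1
  rational : ∀ a ∈ S.Gk.subgroupOf S.T', χ' a = 1

/-- `χ` and `χ'` agree on the centre (N2) -/
def CentralMatch (χ : S.T → ℂ) (χ' : S.T' → ℂ) : Prop :=
  ∀ z : G, ∀ hz : z ∈ S.Z, χ ⟨z, S.ZleT hz⟩ = χ' ⟨z, S.ZleT' hz⟩

/-- left `G(k)`-invariance -/
def Invariant (φ : G → ℂ) : Prop := ∀ γ : S.Gk, ∀ x, φ (γ * x) = φ x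

/-- an invariant subspace of the continuous functions on `G(k)\G` (the DEFINED stand-in for an
automorphic representation: left-invariant, stable under right translation and under every `R(f)`) -/
structure IsInvariantSubspace (V : Set (G → ℂ)) : Prop where
  inv : ∀ φ ∈ V, S.Invariant φ
  cont : ∀ φ ∈ V, Continuous φ
  right : ∀ φ ∈ V, ∀ g : G, (fun x => φ (x * g)) ∈ V
  add : ∀ φ ∈ V, ∀ ψ ∈ V, (fun x => φ x + ψ x) ∈ V
  smul : ∀ φ ∈ V, ∀ c : ℂ, (fun x => c * φ x) ∈ V
  conv : ∀ φ ∈ V, ∀ f, IsTest f → S.R f φ ∈ V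

/-- `V` is (topologically) IRREDUCIBLE: every invariant subspace of `V` is zero or `L²(DG)`-dense in `V` (the
DEFINED trace of «`τ` is an irreducible automorphic representation»; v0.8 — without it the whole space of continuous
invariant functions is an admissible `τ m` and the line's defined conclusion carries no content) -/
def IsIrreducible (V : Set (G → ℂ)) : Prop :=
  ∀ V' : Set (G → ℂ), S.IsInvariantSubspace V' → V' ⊆ V →
    (∀ ψ ∈ V', ∀ x, ψ x = 0) ∨
    ∀ ψ ∈ V, ∀ ε : ℝ, 0 < ε → ∃ ψ' ∈ V',
      eLpNorm (fun x => ψ x - ψ' x) 2 (S.μ.restrict S.DG) < ENNReal.ofReal ε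

/-- an orthonormal family `φ j ∈ τ (n j)` of continuous invariant functions, COMPLETE IN `L²(DG, μ)` (lead S12077 /
crit-2 S12093: completeness against continuous functions only is not enough for Parseval — the counter-model
`G = ℝ`, `Gk = ℤ`, an ONB of `ĝ^⊥` by continuous functions; v0.7 asks completeness for every `ψ ∈ L²(DG)`, with no
invariance binder: every class in `L²(DG)` is the class of an invariant function, and `L²(DG) ≅ L²(G(k)\G)` is what
J1 supplies and what Parseval in L1.2a consumes) -/
structure IsAdaptedONB (τ : ℕ → Set (G → ℂ)) (φ : ℕ → G → ℂ) (n : ℕ → ℕ) : Prop where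
  inv : ∀ m, S.IsInvariantSubspace (τ m)
  irred : ∀ m, S.IsIrreducible (τ m)
  orthSub : ∀ m m', m ≠ m' → ∀ ψ ∈ τ m, ∀ ψ' ∈ τ m', S.inner ψ ψ' = 0
  mem : ∀ j, φ j ∈ τ (n j)
  orth : ∀ j j', S.inner (φ j) (φ j') = if j = j' then 1 else 0
  complete : ∀ ψ : G → ℂ, MemLp ψ 2 (S.μ.restrict S.DG) → (∀ j, S.inner ψ (φ j) = 0) →
    ψ =ᵐ[S.μ.restrict S.DG] 0

/-- `V` is HIT by the test function `f`: `R(f)` is not identically zero on `V` (the DEFINED trace of «`τ` lies in the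
spectral support of `f`» — for `f = e ⋆ f'` with `e` the admissible projector, «`τ` is of admissible type») -/
def Hit (f : G → ℂ) (V : Set (G → ℂ)) : Prop := ∃ ψ ∈ V, ∃ x, S.R f ψ x ≠ 0

/-- the toric period functional is non-zero on `V` -/
def PeriodNonzeroT (χ : S.T → ℂ) (V : Set (G → ℂ)) : Prop :=
  ∃ ψ ∈ V, S.periodT χ (fun t => ψ t) ≠ 0

/-- the second toric period functional is non-zero on `V` -/
def PeriodNonzeroT' (χ' : S.T' → ℂ) (V : Set (G → ℂ)) : Prop :=
  ∃ ψ ∈ V, S.periodT' χ' (fun t' => ψ t') ≠ 0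

/-! ## The generic lemmas of Line 1 (v0.6): statements over any `Setting`; a proof must handle every
instance, so no junk instance helps a prover. Sizes S/M/L are the line's cut. -/


omit [IsTopologicalGroup G] [BorelSpace G] in
/-- glue (S, proved): an orbit outside the geometric support contributes `0`. -/
theorem orbital_eq_zero_of_not_mem (χ : S.T → ℂ) (χ' : S.T' → ℂ) {f : G → ℂ} {o : S.Orbit}
    (ho : o ∉ S.geoSupport f) : S.orbital χ χ' o f = 0 := by
  unfold orbital
  apply MeasureTheory.setIntegral_eq_zero_of_forall_eq_zero
  intro t ht
  apply MeasureTheory.setIntegral_eq_zero_of_forall_eq_zero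
  intro t' ht'
  have hk : S.partialKernel o f t t' = 0 := by
    unfold partialKernel
    have hz : ∀ γ : {γ : S.Gk // S.orbitOf γ = o}, f ((t : G)⁻¹ * γ.1 * t') = 0 := by
      intro γ
      by_contra hne
      exact ho ⟨t, ht, t', ht', γ.1, γ.2, hne⟩
    simp [hz]
  simp [hk]


omit [BorelSpace G] in
/-- L1.5 (S, proved): a non-zero spectral term exhibits both toric functionals on one `τ`. -/
theorem atoms {χ : S.T → ℂ} {χ' : S.T' → ℂ} {τ : ℕ → Set (G → ℂ)} {φ : ℕ → G → ℂ} {n : ℕ → ℕ}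
    (hB : S.IsAdaptedONB τ φ n) {f₁ f₂ : G → ℂ} (h₁ : IsTest f₁) (h₂ : IsTest f₂) (j : ℕ)
    (hj : S.periodT' χ' (fun t' => S.R (refl f₂) (φ j) t') *
        starRingEnd ℂ (S.periodT χ (fun t => S.R (cj f₁) (φ j) t)) ≠ 0) :
    S.PeriodNonzeroT χ (τ (n j)) ∧ S.PeriodNonzeroT' χ' (τ (n j)) ∧ S.Hit (cj f₁) (τ (n j)) := by
  have hmem := hB.mem j
  have hinv := hB.inv (n j)
  have hT : S.periodT χ (fun t => S.R (cj f₁) (φ j) t) ≠ 0 := by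
    intro h0
    apply hj
    rw [h0]
    simp
  refine ⟨⟨S.R (cj f₁) (φ j), hinv.conv _ hmem _ h₁.cj, hT⟩,
    ⟨S.R (refl f₂) (φ j), hinv.conv _ hmem _ h₂.refl, ?_⟩,
    ⟨φ j, hmem, ?_⟩⟩
  · intro h0
    apply hj
    rw [h0]
    simp
  · by_contra hall
    apply hT
    have hz : ∀ t : S.T, S.R (cj f₁) (φ j) t = 0 := fun t => by
      by_contra hne
      exact hall ⟨t, hne⟩
    unfold periodT
    simp [hz]


end Setting

end RTF

end Summit.Ventures.HodgeRepro.Tier4.Line1
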